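import Summits.ABC.IUTFork.LDHTensorHoffM
import Literature.IUT.LogVolume.CompletionLocalFieldsUnramified
import HarnessLib

/-!
# The fork at [IUTchIII] Corollary 3.12, L-DH level (c312-3), II-f: Step (vi) and the stabilisation of the prime
# sums for the idele-built datum over the GENUINE completions `K_{v̲}` — no arithmetic hypothesis left

Record-only file (D-0012) of the abc-iut cell (Cor. 3.12 sub-crew, seat abc-iut-c312-3; plan/D9PRIME-OBLIGATIONS.md
row O3, main line); TAKES NO SIDE. Mochizuki, *Inter-universal Teichmüller theory IV* (RIMS ms Apr. 2020), proof of
Thm. 1.10, Step (vi), kurims p. 29 (the places `v ∉ 𝕍^dst`: odd residue characteristic, `K` unramified — "Such an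
upper bound “`0`”"); Dupuy–Hilado, arXiv:2004.13228 (pre-split text) §1 (1.1) p. 4 (`Σ_p` over all primes),
Def. 3.6.3.

`LDHTensorHoffM.lean` proves Step (vi) for `DHData.ofIdelesM X 𝔽 t_Θ … T …` over ANY local field family `𝔽` under
the named hypotheses "`2 < p`" and "`e(K_{v̲}/ℚ_p) = 1`" off `dst`. For the GENUINE family of abc-iut-S2's
`PlaceSection.localFieldFamily σ` (the rescaled completions `K_{v̲}`, `v̲ = σ.lift v`, of a number field `K ⊇ F₀`)
both hypotheses are THEOREMS off the prime factors of `2·|disc(K)|` (`CompletionLocalFieldsUnramified.lean`,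
Dedekind's discriminant theorem; the elementary bookkeeping on `(2·|disc K|).primeFactors` is done here). Hence, with NO arithmetic hypothesis:
* `hoff_ofIdelesM_completions` — the Step (vi) input `hoff` of `localProofDataAvgOfDH` for every
  `dst ⊇ char(S) ∪ (2·|disc K|).primeFactors`;
* `negLogThetaDHOn_ofIdelesM_completions_eq` — `ln ν̄_{𝕃,T'}(hull(U_Θ)) = ln ν̄_{𝕃,T₀}(hull(U_Θ))` for
  `T' ⊇ T₀ ⊇ char(S) ∪ (2·|disc K|).primeFactors`;
* `cor312DHLim_ofIdelesM_completions_iff_cor312DH` — if `T ⊇ (2·|disc K|).primeFactors` (e.g. abc-iut-S2's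
  `ThetaVolumeInput.supportPrimes = (2·|disc K|).primeFactors ∪ char(S)`), Dupuy–Hilado's (1.1) with `Σ_p` over
  ALL primes (`Cor312DHLim`) is EQUIVALENT to the landed finite form `Cor312DH`.
[cite: Mochizuki2012, IUTchIV Thm 1.10 proof Step (vi) p.29] [cite: DupuyHilado2025, §1 (1.1), Def. 3.6.3]
[cite: NeukirchANT1999, Ch. III Thm. (2.12)] [claim: Mochizuki2012, status: disputed]
HONEST SCOPE: `Cor312DH`/`Cor312DHLim` remain HYPOTHESES on both sides of an `↔`; nothing is asserted about them;
the ideles `t_Θ`, `t_q` (the `q̲_v`-type roots in `K_{v̲}`, [IUTchI] Ex. 3.2 (iv)) remain INPUTS.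
-/

noncomputable section

open Set Finset

namespace Summit.ABC.IUTFork

open Literature.IUT.LogVolume NumberField IsDedekindDomain


/-! ## Primes outside `(2·|disc K|).primeFactors` are odd and unramified in `K` -/

section Support

variable (K : Type) [Field K] [NumberField K]

/-- A prime outside the prime factors of `2·|disc(K)|` is odd. [cite: Mochizuki2012, IUTchIV Thm 1.10 proof Step (vi) p.29] -/
theorem two_lt_of_not_mem_primeFactors_two_mul_discr {p : ℕ} (hp : p.Prime)
    (h : p ∉ (2 * (NumberField.discr K).natAbs).primeFactors) : 2 < p := by
  have hne : 2 * (NumberField.discr K).natAbs ≠ 0 :=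
    mul_ne_zero two_ne_zero (Int.natAbs_ne_zero.mpr (NumberField.discr_ne_zero K))
  have h2 : p ≠ 2 := by
    rintro rfl
    exact h (Nat.mem_primeFactors.mpr ⟨hp, dvd_mul_right 2 _, hne⟩)
  have := hp.two_le
  omega

/-- A prime outside the prime factors of `2·|disc(K)|` does not divide `disc(K)`.
[cite: Mochizuki2012, IUTchIV Thm 1.10 proof Step (vi) p.29] -/
theorem not_dvd_discr_of_not_mem_primeFactors_two_mul_discr {p : ℕ} (hp : p.Prime)
    (h : p ∉ (2 * (NumberField.discr K).natAbs).primeFactors) : ¬ (p : ℤ) ∣ NumberField.discr K := by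
  have hne : 2 * (NumberField.discr K).natAbs ≠ 0 :=
    mul_ne_zero two_ne_zero (Int.natAbs_ne_zero.mpr (NumberField.discr_ne_zero K))
  intro hd
  refine h (Nat.mem_primeFactors.mpr ⟨hp, ?_, hne⟩)
  exact Dvd.dvd.mul_left (Int.natCast_dvd.mp hd) 2

variable {K} {F₀ : Type} [Field F₀] [NumberField F₀] [Algebra F₀ K] (σ : PlaceSection F₀ K)

/-- Off the prime factors of `2·|disc(K)|`, every genuine `K_{v̲}` of `σ.localFieldFamily` is absolutely unramified —
with `two_lt_of_not_mem_primeFactors_two_mul_discr`, exactly the arithmetic hypotheses of `hoff_ofIdelesM` /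
`negLogThetaDHOn_ofIdelesM_eq`. [cite: Mochizuki2012, IUTchIV Thm 1.10 proof Step (vi) p.29] -/
theorem absRamificationIdx_localFieldFamily_eq_one_of_not_mem {p : ℕ} [hp : Fact p.Prime]
    (h : p ∉ (2 * (NumberField.discr K).natAbs).primeFactors) (v : placesOver F₀ p) :
    absRamificationIdx p ((σ.localFieldFamily p hp.out).k v) = 1 :=
  σ.absRamificationIdx_localFieldFamily_eq_one
    (not_dvd_discr_of_not_mem_primeFactors_two_mul_discr K hp.out h) v

end Support

namespace DHData

variable {F₀ K : Type} [Field F₀] [NumberField F₀] [Field K] [NumberField K] [Algebra F₀ K]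
  (σ : PlaceSection F₀ K) (X : PilotData F₀)
  (tΘ : ∀ (p : ℕ) (hp : p.Prime), Fin X.lstar → (v : placesOver F₀ p) →
    (@LocalFields.k F₀ _ _ p ⟨hp⟩ (σ.localFieldFamily p hp) v)ˣ)
  (tΘ_ord : ∀ p hp (i : Fin X.lstar) (v : placesOver F₀ p),
    @LocalFields.ordv F₀ _ _ p ⟨hp⟩ (σ.localFieldFamily p hp) v (tΘ p hp i v) = X.thetaPilot i v.1)
  (tq : ∀ (p : ℕ) (hp : p.Prime), Fin X.lstar → (v : placesOver F₀ p) →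
    (@LocalFields.k F₀ _ _ p ⟨hp⟩ (σ.localFieldFamily p hp) v)ˣ)
  (tq_ord : ∀ p hp (i : Fin X.lstar) (v : placesOver F₀ p),
    @LocalFields.ordv F₀ _ _ p ⟨hp⟩ (σ.localFieldFamily p hp) v (tq p hp i v) = X.qPilot v.1)
  (T : Finset ℕ) (T_prime : ∀ p ∈ T, p.Prime) (S_sub : ∀ v ∈ X.S, residueChar F₀ v ∈ T)

/-- **The Step (vi) input `hoff` over the genuine completions, hypothesis-free**: for the idele-built datum over
`K_{v̲}` (`v̲ = σ.lift v`) and every `dst ⊇ char(S) ∪ (2·|disc K|).primeFactors`, every component of `hull(U_Θ)`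
over `T ∖ dst` in the degrees `1 ≤ j ≤ ℓ⋇` has `log μ̄ ≤ 0`.
[cite: Mochizuki2012, IUTchIV Thm 1.10 proof Step (vi) p.29] [claim: Mochizuki2012, status: disputed] -/
theorem hoff_ofIdelesM_completions (dst : Finset ℕ) (hST : ∀ v ∈ X.S, residueChar F₀ v ∈ dst)
    (hdisc : (2 * (NumberField.discr K).natAbs).primeFactors ⊆ dst) :
    ∀ p ∈ (ofIdelesM X σ.localFieldFamily tΘ tΘ_ord tq tq_ord T T_prime S_sub).T, p ∉ dst → ∀ j, 1 ≤ j →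
      j ≤ (ofIdelesM X σ.localFieldFamily tΘ tΘ_ord tq tq_ord T T_prime S_sub).X.lstar →
        ∀ e : Fin (j + 1) → placesOver F₀ p,
        (ofIdelesM X σ.localFieldFamily tΘ tΘ_ord tq tq_ord T T_prime S_sub).M.logμ
          ((ofIdelesM X σ.localFieldFamily tΘ tΘ_ord tq tq_ord T T_prime S_sub).M.hullUTheta
            (ofIdelesM X σ.localFieldFamily tΘ tΘ_ord tq tq_ord T T_prime S_sub).ind3 p j e) ≤ 0 :=
  hoff_ofIdelesM X σ.localFieldFamily tΘ tΘ_ord tq tq_ord T T_prime S_sub dst hST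
    (fun p hpT hpd => two_lt_of_not_mem_primeFactors_two_mul_discr K (T_prime p hpT) fun h => hpd (hdisc h))
    (fun _ _ _ hpd v => absRamificationIdx_localFieldFamily_eq_one_of_not_mem σ (fun h => hpd (hdisc h)) v)

/-- **Stabilisation over the genuine completions, hypothesis-free**: for `T' ⊇ T₀ ⊇ char(S) ∪
(2·|disc K|).primeFactors`, `ln ν̄_{𝕃,T'}(hull(U_Θ)) = ln ν̄_{𝕃,T₀}(hull(U_Θ))` — the finite sum over `T₀` IS
Dupuy–Hilado's `Σ_p`. [cite: DupuyHilado2025, §1 p. 4, Def. 3.6.3] -/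
theorem negLogThetaDHOn_ofIdelesM_completions_eq (T₀ : Finset ℕ) (hST : ∀ v ∈ X.S, residueChar F₀ v ∈ T₀)
    (hdisc : (2 * (NumberField.discr K).natAbs).primeFactors ⊆ T₀)
    {T' : Finset ℕ} (h : T₀ ⊆ T') (hT' : ∀ p ∈ T', p.Prime) :
    (ofIdelesM X σ.localFieldFamily tΘ tΘ_ord tq tq_ord T T_prime S_sub).negLogThetaDHOn T' =
      (ofIdelesM X σ.localFieldFamily tΘ tΘ_ord tq tq_ord T T_prime S_sub).negLogThetaDHOn T₀ :=
  negLogThetaDHOn_ofIdelesM_eq X σ.localFieldFamily tΘ tΘ_ord tq tq_ord T T_prime S_sub T₀ hST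
    (fun _ hp hpT => two_lt_of_not_mem_primeFactors_two_mul_discr K hp fun h' => hpT (hdisc h'))
    (fun _ _ hpT v => absRamificationIdx_localFieldFamily_eq_one_of_not_mem σ (fun h' => hpT (hdisc h')) v)
    h hT'

/-- **Over the genuine completions, (1.1) with `Σ_p` over ALL primes ⟺ the landed finite `Cor312DH`**, as soon as
`T ⊇ (2·|disc K|).primeFactors` (`T ⊇ char(S)` holds by construction) — e.g. for abc-iut-S2's `supportPrimes`.
HYPOTHESES on both sides; nothing asserted. [claim: Mochizuki2012, status: disputed] -/
theorem cor312DHLim_ofIdelesM_completions_iff_cor312DH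
    (hdisc : (2 * (NumberField.discr K).natAbs).primeFactors ⊆ T) :
    (ofIdelesM X σ.localFieldFamily tΘ tΘ_ord tq tq_ord T T_prime S_sub).Cor312DHLim ↔
      (ofIdelesM X σ.localFieldFamily tΘ tΘ_ord tq tq_ord T T_prime S_sub).Cor312DH :=
  cor312DHLim_ofIdelesM_iff_cor312DH X σ.localFieldFamily tΘ tΘ_ord tq tq_ord T T_prime S_sub
    (fun _ hp hpT => two_lt_of_not_mem_primeFactors_two_mul_discr K hp fun h' => hpT (hdisc h'))
    (fun _ _ hpT v => absRamificationIdx_localFieldFamily_eq_one_of_not_mem σ (fun h' => hpT (hdisc h')) v)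

end DHData

end Summit.ABC.IUTFork

end
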